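import Literature.Probability.Percolation.Z2PivotalMeasureIntegral
import Literature.Probability.Percolation.QuadCrossingSubseqLimits
import Summits.CriticalPhenomena.CardyFormulaZ2.Theorems.CardyMeckeFlipLatticeFlipIdentity

/-!
# Crux `FlipErgodicityZ2` (stmt-CriticalPhenomena-14825), line `birth`: stub 2a `stub_latticeCampbellKernel`

Route `Summits/CriticalPhenomena/CardyFormulaZ2/Theses/CardyMeckeFlip`.  **The exact lattice
Campbell–Mecke (flip) identity in pivotal-KERNEL form** for bond percolation on `δℤ²` at `p = ½`
and the isometry-averaged Garban–Pete–Schramm measures `μ^ε_δ(ω) = Σ_e w_e(ω) δ_{mid e}`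
(`z2PivotalMeasure`): for every cutoff `ε > 0`, mesh `δ > 0`, finite family of quads `Q`, every
`g` and every `φ ∈ C_c(ℂ)`,

  `E[ ∫ φ(x) g({i | Qᵢ ∈ ω_δ}) μ^ε_δ(ω)(dx) ] = E[ Σ_e w_e(ω) φ(mid e) g({i | Qᵢ ∈ (ω Δ {e})_δ}) ]`,

and `{i | Qᵢ ∈ (ω Δ {e})_δ}` is the pattern of `ω` toggled at the lattice-pivotal indices — i.e.
clause (F) of the route at mesh `δ` with LATTICE pivotality (registered stub
`stub_latticeCampbellKernel` of the reshaped birth skeleton; node (A) of the wave-1 census of the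
limit-passage stub).  Proof: the left side is a finite sum `Σ_e φ(mid e) E[w_e g(pattern(ω))]`
(local finiteness, `integral_z2PivotalMeasure_eq_sum`), and edge by edge
`E[w_e G(ω)] = E[w_e G(ω^e)]` because `ω ↦ ω^e` preserves `P_½`
(`measurePreserving_symmDiff_singleton_setBernoulli_half`, from the route's proved
`LatticeFlipIdentity` file) and `w_e(ω^e) = w_e(ω)` (`pivotalWeight_symmDiff`).  Measurability of
the weights and the finite-sum formula are the Literature file `Z2PivotalMeasureIntegral.lean`.
-/

noncomputable section

open MeasureTheory Set Filter Metric
open Literature.Probability.Percolation Literature.Probability.Percolation.QuadCrossing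
open Literature.Probability.LatticeModels
open scoped symmDiff ENNReal Topology

namespace Summit.CriticalPhenomena.CardyFormulaZ2.Theorems.CardyMeckeFlip

/-! ### Flip invariance of `P_½`-expectations and the per-edge Campbell identity -/

/-- **Flip invariance of `P_½`**: for a genuine edge `e` of `ℤ²` and ANY real function `F` of the
configuration, `E[F(ω Δ {e})] = E[F(ω)]` — change of variables along the measure-preserving
involution `ω ↦ ω Δ {e}` (no measurability of `F` is needed: the flip is a measurable
embedding). [folklore] -/
theorem integral_comp_symmDiff_singleton {e : Sym2 (Site 2)} (he : e ∈ (zdGraph 2).edgeSet)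
    (F : BondConfig (Site 2) → ℝ) :
    ∫ ω, F (ω ∆ {e}) ∂(bondPercolation (zdGraph 2) half) =
      ∫ ω, F ω ∂(bondPercolation (zdGraph 2) half) :=
  (measurePreserving_symmDiff_singleton_setBernoulli_half he).integral_comp
    (measurableEmbedding_symmDiff_singleton e) F

/-- **Per-edge Campbell–Mecke identity** for the isometry-averaged GPS weight: since the weight
of the edge `e = s(x, x + eᵢ)` is symmetric under flipping `e` (`pivotalWeight_symmDiff`) and the
flip preserves `P_½`, `E[w_e(ω) G(ω Δ {e})] = E[w_e(ω) G(ω)]` for every `G`. [folklore] -/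
theorem integral_pivotalWeight_mul_comp_flip (ε δ : ℝ) (x : Site 2) (i : Fin 2)
    (G : BondConfig (Site 2) → ℝ) :
    ∫ ω, (pivotalWeight ε δ ω x i).toReal * G (ω ∆ {edgeFrom x i})
        ∂(bondPercolation (zdGraph 2) half) =
      ∫ ω, (pivotalWeight ε δ ω x i).toReal * G ω ∂(bondPercolation (zdGraph 2) half) := by
  have h := integral_comp_symmDiff_singleton (edgeFrom_mem_edgeSet x i)
    (fun ω => (pivotalWeight ε δ ω x i).toReal * G ω)
  simpa only [pivotalWeight_symmDiff] using h

/-! ### Measurability of the crossing pattern -/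

/-- **The crossing pattern of finitely many quads is a measurable function of `ω`** (`δ > 0`),
and so is any function of it (`measurable_z2QuadConfig`, `measurableSet_preimage_crossedEvent`).
[folklore] -/
theorem measurable_comp_crossingPattern {n : ℕ} (Q : Fin n → Quad (univ : Set ℂ))
    {β : Type*} [MeasurableSpace β] (g : Set (Fin n) → β) {δ : ℝ} (hδ : 0 < δ) :
    Measurable fun ω : BondConfig (Site 2) => g {i | Q i ∈ z2QuadConfig (univ : Set ℂ) δ ω} := by
  have hpat : Measurable fun ω : BondConfig (Site 2) =>
      {i | Q i ∈ z2QuadConfig (univ : Set ℂ) δ ω} := by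
    refine measurable_set_iff.2 fun i => ?_
    exact measurableSet_setOf.1 (measurableSet_preimage_crossedEvent hδ (Q i))
  exact (measurable_of_countable g).comp hpat

/-- A function of the crossing pattern is bounded by the sum of its absolute values over all
patterns. [folklore] -/
theorem abs_apply_le_sum_abs {n : ℕ} (g : Set (Fin n) → ℝ) (A : Set (Fin n)) :
    |g A| ≤ ∑ B : Set (Fin n), |g B| :=
  Finset.single_le_sum (f := fun B => |g B|) (fun _ _ => abs_nonneg _) (Finset.mem_univ A)

/-! ### The lattice Campbell–Mecke identity in kernel form -/

/-- Integrability of `ω ↦ w_e(ω) · c · G(ω)` for a bounded measurable `G` under `P_½`.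
[folklore] -/
theorem integrable_pivotalWeight_mul {ε δ : ℝ} (hε : 0 < ε) (hδ : 0 < δ) (p : Site 2 × Fin 2)
    (c : ℝ) {G : BondConfig (Site 2) → ℝ} (hG : Measurable G) {C : ℝ} (hC : ∀ ω, |G ω| ≤ C) :
    Integrable (fun ω => (pivotalWeight ε δ ω p.1 p.2).toReal * (c * G ω))
      (bondPercolation (zdGraph 2) half) := by
  haveI : IsProbabilityMeasure (bondPercolation (zdGraph 2) half) := by
    unfold bondPercolation; infer_instance
  refine Integrable.of_bound
    (((measurable_pivotalWeight_toReal hε hδ p.1 p.2).mul (measurable_const.mul hG))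
      |>.aestronglyMeasurable) (pivotalRate δ * (|c| * C)) (ae_of_all _ fun ω => ?_)
  rw [Real.norm_eq_abs, abs_mul, abs_mul,
    abs_of_nonneg (ENNReal.toReal_nonneg : 0 ≤ (pivotalWeight ε δ ω p.1 p.2).toReal)]
  exact mul_le_mul (pivotalWeight_toReal_le ε δ ω p.1 p.2)
    (mul_le_mul_of_nonneg_left (hC ω) (abs_nonneg c)) (mul_nonneg (abs_nonneg _) (abs_nonneg _))
    (pivotalRate_nonneg δ)

/-- **Node (A): the exact lattice Campbell–Mecke (flip) identity in pivotal-kernel form.**  For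
bond percolation on `δℤ²` at `p = ½`, the isometry-averaged GPS measure
`μ^ε_δ(ω) = Σ_e w_e(ω) δ_{mid e}`, every finite family of quads `Q`, every `g` and every
`φ ∈ C_c(ℂ)`:
`E[∫ φ(x) g({i | Qᵢ ∈ ω_δ}) μ^ε_δ(ω)(dx)] = E[Σ_e w_e(ω) φ(mid e) g({i | Qᵢ ∈ (ω Δ {e})_δ})]`,
the sum running over any finite set of edges containing those charged by `φ`.  Proof: the left
side is `Σ_e φ(mid e) E[w_e g(pattern(ω))]` (local finiteness), and edge by edge
`E[w_e G(ω)] = E[w_e G(ω^e)]` because `ω ↦ ω^e` preserves `P_½` and `w_e(ω^e) = w_e(ω)`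
(`integral_pivotalWeight_mul_comp_flip`).  This is clause (F) at mesh `δ` with the LATTICE
pivotality predicate (see `setOf_mem_symmDiff_eq_toggled`). [folklore] -/
theorem campbellFlip_lattice {ε δ : ℝ} (hε : 0 < ε) (hδ : 0 < δ) {n : ℕ}
    (Q : Fin n → Quad (univ : Set ℂ)) (g : Set (Fin n) → ℝ) {φ : ℂ → ℝ} (hφ : Continuous φ)
    (hφc : HasCompactSupport φ) (E : Finset (Site 2 × Fin 2))
    (hE : ∀ p : Site 2 × Fin 2, φ (edgeMidpoint δ p.1 p.2) ≠ 0 → p ∈ E) :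
    ∫ ω, ∫ z, φ z * g {i | Q i ∈ z2QuadConfig (univ : Set ℂ) δ ω} ∂(z2PivotalMeasure ε δ ω)
        ∂(bondPercolation (zdGraph 2) half) =
      ∫ ω, ∑ p ∈ E, (pivotalWeight ε δ ω p.1 p.2).toReal *
          (φ (edgeMidpoint δ p.1 p.2) *
            g {i | Q i ∈ z2QuadConfig (univ : Set ℂ) δ (ω ∆ {edgeFrom p.1 p.2})})
        ∂(bondPercolation (zdGraph 2) half) := by
  set G : BondConfig (Site 2) → ℝ := fun ω => g {i | Q i ∈ z2QuadConfig (univ : Set ℂ) δ ω}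
    with hGdef
  have hGm : Measurable G := measurable_comp_crossingPattern Q g hδ
  have hGb : ∀ ω, |G ω| ≤ ∑ B : Set (Fin n), |g B| := fun ω => abs_apply_le_sum_abs g _
  -- the inner integral is a finite sum, configuration by configuration
  have hinner : ∀ ω, ∫ z, φ z * G ω ∂(z2PivotalMeasure ε δ ω) =
      ∑ p ∈ E, (pivotalWeight ε δ ω p.1 p.2).toReal * (φ (edgeMidpoint δ p.1 p.2) * G ω) := by
    intro ω
    refine integral_z2PivotalMeasure_eq_sum ε hδ ω (f := fun z => φ z * G ω)
      (hφ.mul continuous_const) (hφc.mul_right (f' := fun _ => G ω)) E fun p hp => hE p ?_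
    exact fun h => hp (by simp only [h, zero_mul])
  show ∫ ω, ∫ z, φ z * G ω ∂(z2PivotalMeasure ε δ ω) ∂(bondPercolation (zdGraph 2) half) =
    ∫ ω, ∑ p ∈ E, (pivotalWeight ε δ ω p.1 p.2).toReal *
      (φ (edgeMidpoint δ p.1 p.2) * G (ω ∆ {edgeFrom p.1 p.2})) ∂(bondPercolation (zdGraph 2) half)
  simp_rw [hinner]
  -- swap the finite sum and the expectation on both sides
  have hint₁ : ∀ p ∈ E, Integrable
      (fun ω => (pivotalWeight ε δ ω p.1 p.2).toReal * (φ (edgeMidpoint δ p.1 p.2) * G ω))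
      (bondPercolation (zdGraph 2) half) :=
    fun p _ => integrable_pivotalWeight_mul hε hδ p _ hGm hGb
  have hint₂ : ∀ p ∈ E, Integrable
      (fun ω => (pivotalWeight ε δ ω p.1 p.2).toReal *
        (φ (edgeMidpoint δ p.1 p.2) * G (ω ∆ {edgeFrom p.1 p.2})))
      (bondPercolation (zdGraph 2) half) :=
    fun p _ => integrable_pivotalWeight_mul hε hδ p _
      (hGm.comp (measurable_symmDiff_singleton _)) (fun ω => hGb _)
  rw [integral_finsetSum E hint₁, integral_finsetSum E hint₂]
  refine Finset.sum_congr rfl fun p _ => ?_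
  -- edge by edge: the Campbell identity with the flip-symmetric weight
  exact (integral_pivotalWeight_mul_comp_flip ε δ p.1 p.2
    (fun ω => φ (edgeMidpoint δ p.1 p.2) * G ω)).symm

/-- **On the lattice the flipped pattern IS the toggled pattern**: the crossing pattern of
`ω Δ {e}` is the pattern of `ω` toggled exactly at the indices `i` for which `e` is
lattice-pivotal for `Qᵢ` (its crossing status differs between `ω` and `ω Δ {e}`) — pure logic;
it identifies `campbellFlip_lattice` with clause (F) at mesh `δ` for the lattice pivotality
predicate. [folklore] -/
theorem setOf_mem_symmDiff_eq_toggled {n : ℕ} (Q : Fin n → Quad (univ : Set ℂ)) (δ : ℝ)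
    (ω : BondConfig (Site 2)) (e : Sym2 (Site 2)) :
    {i | Q i ∈ z2QuadConfig (univ : Set ℂ) δ (ω ∆ {e})} =
      {i | Xor (Q i ∈ z2QuadConfig (univ : Set ℂ) δ ω)
        (¬ (Q i ∈ z2QuadConfig (univ : Set ℂ) δ ω ↔
            Q i ∈ z2QuadConfig (univ : Set ℂ) δ (ω ∆ {e})))} := by
  ext i
  simp only [mem_setOf_eq, Xor]
  tauto

/-- **Node (A) in clause-(F) shape**: the lattice Campbell–Mecke identity with the toggled
pattern written with `Xor`, exactly as in `IsFlipFairKernel`, the continuum predicate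
`IsPivotalAt S x Q` being replaced by lattice pivotality of the edge at `x`. [folklore] -/
theorem campbellFlip_lattice_toggled {ε δ : ℝ} (hε : 0 < ε) (hδ : 0 < δ) {n : ℕ}
    (Q : Fin n → Quad (univ : Set ℂ)) (g : Set (Fin n) → ℝ) {φ : ℂ → ℝ} (hφ : Continuous φ)
    (hφc : HasCompactSupport φ) (E : Finset (Site 2 × Fin 2))
    (hE : ∀ p : Site 2 × Fin 2, φ (edgeMidpoint δ p.1 p.2) ≠ 0 → p ∈ E) :
    ∫ ω, ∫ z, φ z * g {i | Q i ∈ z2QuadConfig (univ : Set ℂ) δ ω} ∂(z2PivotalMeasure ε δ ω)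
        ∂(bondPercolation (zdGraph 2) half) =
      ∫ ω, ∑ p ∈ E, (pivotalWeight ε δ ω p.1 p.2).toReal *
          (φ (edgeMidpoint δ p.1 p.2) *
            g {i | Xor (Q i ∈ z2QuadConfig (univ : Set ℂ) δ ω)
              (¬ (Q i ∈ z2QuadConfig (univ : Set ℂ) δ ω ↔
                Q i ∈ z2QuadConfig (univ : Set ℂ) δ (ω ∆ {edgeFrom p.1 p.2})))})
        ∂(bondPercolation (zdGraph 2) half) := by
  simp_rw [← setOf_mem_symmDiff_eq_toggled]
  exact campbellFlip_lattice hε hδ Q g hφ hφc E hE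

/-! ### The registered stub -/

/-- **Stub 2a of the birth skeleton of crux `FlipErgodicityZ2` — the exact lattice Campbell–Mecke
identity in kernel form**, verbatim the registered signature: for `0 < ε`, `0 < δ`, every finite
quad family `Q`, every `g`, every `φ ∈ C_c(ℂ)` and every finite set of edges `E` containing those
charged by `φ`, `E[∫ φ g(pattern(ω_δ)) dμ^ε_δ(ω)]` equals
`E[Σ_{e ∈ E} w_e(ω) φ(mid e) g(pattern(ω_δ) toggled where e is lattice-pivotal)]`. [folklore] -/
theorem stub_latticeCampbellKernel :
    ∀ (ε δ : ℝ), 0 < ε → 0 < δ → ∀ (n : ℕ) (Q : Fin n → Quad (Set.univ : Set ℂ))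
      (g : Set (Fin n) → ℝ) (φ : ℂ → ℝ), Continuous φ → HasCompactSupport φ →
        ∀ E : Finset (Site 2 × Fin 2),
          (∀ p : Site 2 × Fin 2, φ (edgeMidpoint δ p.1 p.2) ≠ 0 → p ∈ E) →
            ∫ ω, ∫ z, φ z * g {i | Q i ∈ z2QuadConfig (Set.univ : Set ℂ) δ ω}
                ∂(z2PivotalMeasure ε δ ω) ∂(bondPercolation (zdGraph 2) half) =
              ∫ ω, ∑ p ∈ E, (pivotalWeight ε δ ω p.1 p.2).toReal *
                  (φ (edgeMidpoint δ p.1 p.2) *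
                    g {i | Xor (Q i ∈ z2QuadConfig (Set.univ : Set ℂ) δ ω)
                      (¬ (Q i ∈ z2QuadConfig (Set.univ : Set ℂ) δ ω ↔
                        Q i ∈ z2QuadConfig (Set.univ : Set ℂ) δ (symmDiff ω {edgeFrom p.1 p.2})))})
                ∂(bondPercolation (zdGraph 2) half) :=
  fun _ε _δ hε hδ _n Q g _φ hφ hφc E hE => campbellFlip_lattice_toggled hε hδ Q g hφ hφc E hE

end Summit.CriticalPhenomena.CardyFormulaZ2.Theorems.CardyMeckeFlip

end
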